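import Mathlib
import Literature.AlgebraicGeometry.Resolution.AffineBlowupIntegral
import Summits.ResolutionOfSingularities.ResolutionOfSingularities.Theorems.WildQuotientsWildQuotientResolutionJordanThreeOneBlowup
import Summits.ResolutionOfSingularities.ResolutionOfSingularities.Theorems.WildQuotientsWildQuotientResolutionThird112ChartB3
import Summits.ResolutionOfSingularities.ResolutionOfSingularities.Theorems.WildQuotientsWildQuotientResolutionThird112ChartC3
import Summits.ResolutionOfSingularities.ResolutionOfSingularities.Theorems.WildQuotientsWildQuotientResolutionThird112ChartAC
import Summits.ResolutionOfSingularities.ResolutionOfSingularities.Theorems.WildQuotientsWildQuotientResolutionThird112ChartBC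

/-!
# V4U `μ₃`-exit: ONE blow-up resolves `⅓(1,1,2) × 𝔸^{n−3}`

(crux stmt-ResolutionOfSingularities-15640 `WildQuotients.WildQuotientResolution`, line `Sketch`,
sector `|G| = p`; programme V4U of `L/w45c/CHAIN.md` v5 — stub-4 FINDING V4U-μ₃/μ₂-EXIT
2026-08-27T04:2xZ. [OURS · L1 W4.5c] — NOT a statement of any manuscript; replaces the role of no
printed item. Prover res-L1-w45c-stub-4.)

The blow-up of the presented ring `A = k[Y]/ker (Third112.presentation)` (`≅ R₃ ⊗ k[passengers]`,
`R₃ = k[y₁³, y₂³, y₃³, y₁²y₂, y₁y₂², y₁y₃, y₂y₃]` the invariant ring of `⅓(1,1,2)`) along the ideal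
`𝔪` of the seven generator classes is REGULAR, integral, and proper birational over `Spec A`: the
five Newton-vertex charts `D₊(y₁³t), D₊(y₂³t), D₊(y₃³t), D₊(y₁y₃t), D₊(y₂y₃t)` are affine spaces
(`…Third112Chart{A3,B3,C3,AC,BC}`), and the two edge charts `D₊(y₁²y₂ t), D₊(y₁y₂² t)` lie in
`D₊(y₁³t)` (`(y₁²y₂ t)³ = (y₂³ t)(y₁³ t)²`, `(y₁y₂² t)³ = (y₁³ t)(y₂³ t)²` in the Rees algebra).
This is the one-blow-up input `hP` of stub-3's `BlowupExit.hasResolution_of_isBlowup_local` for the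
quotient piece over the `x_a`-vertex curve of `Bl_{I₆} 𝔸ⁿ` (p ≡ 1: `y = (ρ, N, c′)`; p ≡ 2:
`y = (N, c′, ρ)`).
-/

-- single-problem summit: the doubled namespace component `ResolutionOfSingularities` is forced
set_option linter.dupNamespace false

noncomputable section

open CategoryTheory AlgebraicGeometry MvPolynomial
open Literature.AlgebraicGeometry.Resolution

namespace Summit.ResolutionOfSingularities.ResolutionOfSingularities.Theorems.WildQuotientResolution.Third112

-- keep the presentation opaque for the unifier (the `Proj.basicOpen` rewrites below otherwise
-- unfold `aeval` terms inside the quotient ring's index and time out)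
attribute [local irreducible] presentation

variable (k : Type) [Field k] (n : ℕ) (a b c : Fin n)

/-- In the Rees algebra of `𝔪`: `(y₁²y₂ t)³ = (y₂³ t) · (y₁³ t)²`. [folklore] -/
theorem reesT_three_cube (hab : a ≠ b) (hbc : b ≠ c) (hac : a ≠ c) :
    reesT ((fun l : Fin 7 => Ideal.Quotient.mk (RingHom.ker (presentation k n a b c))
        (gens k n a b c l)) 3) (Ideal.mem_span_range_self (f := fun l : Fin 7 =>
        Ideal.Quotient.mk (RingHom.ker (presentation k n a b c)) (gens k n a b c l)) (x := 3)) ^ 3 =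
      reesT ((fun l : Fin 7 => Ideal.Quotient.mk (RingHom.ker (presentation k n a b c))
        (gens k n a b c l)) 1) (Ideal.mem_span_range_self (f := fun l : Fin 7 =>
        Ideal.Quotient.mk (RingHom.ker (presentation k n a b c)) (gens k n a b c l)) (x := 1)) *
      reesT ((fun l : Fin 7 => Ideal.Quotient.mk (RingHom.ker (presentation k n a b c))
        (gens k n a b c l)) 0) (Ideal.mem_span_range_self (f := fun l : Fin 7 =>
        Ideal.Quotient.mk (RingHom.ker (presentation k n a b c)) (gens k n a b c l)) (x := 0)) *
      reesT ((fun l : Fin 7 => Ideal.Quotient.mk (RingHom.ker (presentation k n a b c))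
        (gens k n a b c l)) 0) (Ideal.mem_span_range_self (f := fun l : Fin 7 =>
        Ideal.Quotient.mk (RingHom.ker (presentation k n a b c)) (gens k n a b c l)) (x := 0)) := by
  apply Subtype.ext
  simp only [Subalgebra.coe_pow, Subalgebra.coe_mul, coe_reesT, Polynomial.monomial_pow,
    Polynomial.monomial_mul_monomial]
  have hrel : (Ideal.Quotient.mk (RingHom.ker (presentation k n a b c)) (gens k n a b c 3)) ^ 3 =
      Ideal.Quotient.mk (RingHom.ker (presentation k n a b c)) (gens k n a b c 1) *
        Ideal.Quotient.mk (RingHom.ker (presentation k n a b c)) (gens k n a b c 0) *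
        Ideal.Quotient.mk (RingHom.ker (presentation k n a b c)) (gens k n a b c 0) := by
    rw [← map_pow, ← map_mul, ← map_mul]
    apply mk_eq_of_presentation_eq
    rw [map_pow, map_mul, map_mul, presentation_gens k n a b c hab hbc hac,
      presentation_gens k n a b c hab hbc hac, presentation_gens k n a b c hab hbc hac]
    simp
    ring
  rw [hrel]

/-- In the Rees algebra of `𝔪`: `(y₁y₂² t)³ = (y₂³ t) · (y₂³ t) · (y₁³ t)`. [folklore] -/
theorem reesT_four_cube (hab : a ≠ b) (hbc : b ≠ c) (hac : a ≠ c) :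
    reesT ((fun l : Fin 7 => Ideal.Quotient.mk (RingHom.ker (presentation k n a b c))
        (gens k n a b c l)) 4) (Ideal.mem_span_range_self (f := fun l : Fin 7 =>
        Ideal.Quotient.mk (RingHom.ker (presentation k n a b c)) (gens k n a b c l)) (x := 4)) ^ 3 =
      reesT ((fun l : Fin 7 => Ideal.Quotient.mk (RingHom.ker (presentation k n a b c))
        (gens k n a b c l)) 1) (Ideal.mem_span_range_self (f := fun l : Fin 7 =>
        Ideal.Quotient.mk (RingHom.ker (presentation k n a b c)) (gens k n a b c l)) (x := 1)) *
      reesT ((fun l : Fin 7 => Ideal.Quotient.mk (RingHom.ker (presentation k n a b c))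
        (gens k n a b c l)) 1) (Ideal.mem_span_range_self (f := fun l : Fin 7 =>
        Ideal.Quotient.mk (RingHom.ker (presentation k n a b c)) (gens k n a b c l)) (x := 1)) *
      reesT ((fun l : Fin 7 => Ideal.Quotient.mk (RingHom.ker (presentation k n a b c))
        (gens k n a b c l)) 0) (Ideal.mem_span_range_self (f := fun l : Fin 7 =>
        Ideal.Quotient.mk (RingHom.ker (presentation k n a b c)) (gens k n a b c l)) (x := 0)) := by
  apply Subtype.ext
  simp only [Subalgebra.coe_pow, Subalgebra.coe_mul, coe_reesT, Polynomial.monomial_pow,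
    Polynomial.monomial_mul_monomial]
  have hrel : (Ideal.Quotient.mk (RingHom.ker (presentation k n a b c)) (gens k n a b c 4)) ^ 3 =
      Ideal.Quotient.mk (RingHom.ker (presentation k n a b c)) (gens k n a b c 1) *
        Ideal.Quotient.mk (RingHom.ker (presentation k n a b c)) (gens k n a b c 1) *
        Ideal.Quotient.mk (RingHom.ker (presentation k n a b c)) (gens k n a b c 0) := by
    rw [← map_pow, ← map_mul, ← map_mul]
    apply mk_eq_of_presentation_eq
    rw [map_pow, map_mul, map_mul, presentation_gens k n a b c hab hbc hac,
      presentation_gens k n a b c hab hbc hac, presentation_gens k n a b c hab hbc hac]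
    simp
    ring
  rw [hrel]

/-- **The edge chart `D₊(y₁²y₂ t)` lies in `D₊(y₁³ t)`.** [folklore] -/
theorem basicOpen_three_le (hab : a ≠ b) (hbc : b ≠ c) (hac : a ≠ c) :
    Proj.basicOpen (reesGrading (Ideal.span (Set.range (fun l : Fin 7 =>
        Ideal.Quotient.mk (RingHom.ker (presentation k n a b c)) (gens k n a b c l)))))
      (reesT ((fun l : Fin 7 => Ideal.Quotient.mk (RingHom.ker (presentation k n a b c))
        (gens k n a b c l)) 3) (Ideal.mem_span_range_self (f := fun l : Fin 7 =>
        Ideal.Quotient.mk (RingHom.ker (presentation k n a b c)) (gens k n a b c l)) (x := 3))) ≤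
    Proj.basicOpen (reesGrading (Ideal.span (Set.range (fun l : Fin 7 =>
        Ideal.Quotient.mk (RingHom.ker (presentation k n a b c)) (gens k n a b c l)))))
      (reesT ((fun l : Fin 7 => Ideal.Quotient.mk (RingHom.ker (presentation k n a b c))
        (gens k n a b c l)) 0) (Ideal.mem_span_range_self (f := fun l : Fin 7 =>
        Ideal.Quotient.mk (RingHom.ker (presentation k n a b c)) (gens k n a b c l)) (x := 0))) := by
  have e1 := Proj.basicOpen_pow (reesGrading (Ideal.span (Set.range (fun l : Fin 7 =>
      Ideal.Quotient.mk (RingHom.ker (presentation k n a b c)) (gens k n a b c l)))))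
    (reesT ((fun l : Fin 7 =>
      Ideal.Quotient.mk (RingHom.ker (presentation k n a b c)) (gens k n a b c l)) 3) (Ideal.mem_span_range_self (f := (fun l : Fin 7 => Ideal.Quotient.mk (RingHom.ker (presentation k n a b c)) (gens k n a b c l))) (x := 3))) 3 (by norm_num)
  rw [← e1, reesT_three_cube k n a b c hab hbc hac, Proj.basicOpen_mul]
  exact inf_le_right

/-- **The edge chart `D₊(y₁y₂² t)` lies in `D₊(y₁³ t)`.** [folklore] -/
theorem basicOpen_four_le (hab : a ≠ b) (hbc : b ≠ c) (hac : a ≠ c) :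
    Proj.basicOpen (reesGrading (Ideal.span (Set.range (fun l : Fin 7 =>
        Ideal.Quotient.mk (RingHom.ker (presentation k n a b c)) (gens k n a b c l)))))
      (reesT ((fun l : Fin 7 => Ideal.Quotient.mk (RingHom.ker (presentation k n a b c))
        (gens k n a b c l)) 4) (Ideal.mem_span_range_self (f := fun l : Fin 7 =>
        Ideal.Quotient.mk (RingHom.ker (presentation k n a b c)) (gens k n a b c l)) (x := 4))) ≤
    Proj.basicOpen (reesGrading (Ideal.span (Set.range (fun l : Fin 7 =>
        Ideal.Quotient.mk (RingHom.ker (presentation k n a b c)) (gens k n a b c l)))))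
      (reesT ((fun l : Fin 7 => Ideal.Quotient.mk (RingHom.ker (presentation k n a b c))
        (gens k n a b c l)) 0) (Ideal.mem_span_range_self (f := fun l : Fin 7 =>
        Ideal.Quotient.mk (RingHom.ker (presentation k n a b c)) (gens k n a b c l)) (x := 0))) := by
  have e1 := Proj.basicOpen_pow (reesGrading (Ideal.span (Set.range (fun l : Fin 7 =>
      Ideal.Quotient.mk (RingHom.ker (presentation k n a b c)) (gens k n a b c l)))))
    (reesT ((fun l : Fin 7 =>
      Ideal.Quotient.mk (RingHom.ker (presentation k n a b c)) (gens k n a b c l)) 4) (Ideal.mem_span_range_self (f := (fun l : Fin 7 => Ideal.Quotient.mk (RingHom.ker (presentation k n a b c)) (gens k n a b c l))) (x := 4))) 3 (by norm_num)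
  rw [← e1, reesT_four_cube k n a b c hab hbc hac, Proj.basicOpen_mul]
  exact inf_le_right

/-- **E₃-UP: `Bl_𝔪 (⅓(1,1,2) × 𝔸^{n−3})` is regular, integral, and proper birational** — ONE
blow-up of the reduced singular locus resolves the `μ₃`-exit piece (five affine-space vertex charts,
two edge charts inside `D₊(y₁³ t)`). [OURS · L1 W4.5c] -/
theorem blowup_regular (hab : a ≠ b) (hbc : b ≠ c) (hac : a ≠ c) :
    Scheme.IsRegular (affineBlowup (Ideal.span (Set.range (fun l : Fin 7 =>
        Ideal.Quotient.mk (RingHom.ker (presentation k n a b c)) (gens k n a b c l))))) ∧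
      IsIntegral (affineBlowup (Ideal.span (Set.range (fun l : Fin 7 =>
        Ideal.Quotient.mk (RingHom.ker (presentation k n a b c)) (gens k n a b c l))))) ∧
      IsProper (affineBlowup.π (Ideal.span (Set.range (fun l : Fin 7 =>
        Ideal.Quotient.mk (RingHom.ker (presentation k n a b c)) (gens k n a b c l))))) ∧
      IsBirational (affineBlowup.π (Ideal.span (Set.range (fun l : Fin 7 =>
        Ideal.Quotient.mk (RingHom.ker (presentation k n a b c)) (gens k n a b c l))))) := by
  haveI : (RingHom.ker (presentation k n a b c)).IsPrime := RingHom.ker_isPrime _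
  haveI : IsDomain (MvPolynomial (Fin n ⊕ Fin 4) k ⧸ RingHom.ker (presentation k n a b c)) :=
    (Ideal.Quotient.isDomain_iff_prime _).mpr inferInstance
  have hne : Ideal.span (Set.range (fun l : Fin 7 =>
      Ideal.Quotient.mk (RingHom.ker (presentation k n a b c)) (gens k n a b c l))) ≠ ⊥ := by
    intro h
    rw [Ideal.span_eq_bot] at h
    have h0 := h _ ⟨0, rfl⟩
    change Ideal.Quotient.mk (RingHom.ker (presentation k n a b c)) (gens k n a b c 0) = 0 at h0
    rw [Ideal.Quotient.eq_zero_iff_mem, RingHom.mem_ker, presentation_gens k n a b c hab hbc hac]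
      at h0
    simp only [Matrix.cons_val_zero] at h0
    exact pow_ne_zero 3 (X_ne_zero (R := k) a) h0
  refine ⟨JordanThree.isRegular_affineBlowup_of_charts _ fun i => ?_, affineBlowup.isIntegral hne,
    inferInstance, affineBlowup.isBirational hne⟩
  fin_cases i
  · exact ⟨0, isRegularRing_chartRing_zero k n a b c hab hbc hac, le_rfl⟩
  · exact ⟨1, isRegularRing_chartRing_one k n a b c hab hbc hac, le_rfl⟩
  · exact ⟨2, isRegularRing_chartRing_two k n a b c hab hbc hac, le_rfl⟩
  · exact ⟨0, isRegularRing_chartRing_zero k n a b c hab hbc hac,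
      basicOpen_three_le k n a b c hab hbc hac⟩
  · exact ⟨0, isRegularRing_chartRing_zero k n a b c hab hbc hac,
      basicOpen_four_le k n a b c hab hbc hac⟩
  · exact ⟨5, isRegularRing_chartRing_five k n a b c hab hbc hac, le_rfl⟩
  · exact ⟨6, isRegularRing_chartRing_six k n a b c hab hbc hac, le_rfl⟩

end Summit.ResolutionOfSingularities.ResolutionOfSingularities.Theorems.WildQuotientResolution.Third112

end
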